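import Summits.QuantumFields.BalabanUV.Beta.HessKerDressedUnits
import Summits.QuantumFields.BalabanUV.Beta.AxialDressingRootedLegs

/-!
# `BalabanUV.Beta.AxialDressingRootedUnits` — an2's ROOTED axial dressings are ADDITIVE and COMMUTE WITH LEG UNITS; transport of the
# pointwise (St)/(W) rows and of their deviations through `dressAt` (asymptotic lane asym1, gen 17, v1, part 2 of 3;
# part 1 = `HessKerFourFamily`, part 3 = `HessKerRootedWall`)

HONEST FRAMING (cell contract, verbatim): «discharging `BetaPertH` makes Bałaban's UV stability UNCONDITIONAL — a real
constructive-QFT result; it is NOT the continuum limit and NOT the Clay problem.»  THIS MODULE is finite-sum ALGEBRA of an2's rooted dressing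
operators (`AxialDressingRooted.coProjAt`, `legCo₁At`, `legCo₂At`, `dressKAt`, `coProjAtK`; any dimension `d`, any root `ρ`, any level `N`)
and their interaction with part 1's leg units (`HessKerDressedUnits.unitS`, `unitW`, `legScale`); it formalises NO statement printed in
Bałaban's papers, cites none, mints no `Prop` fact, instantiates NO binder of the β-function wall and DISCHARGES NOTHING of it.  NOT summit
progress.

ABSOLUTE RULE (cell, verbatim): «No internally-minted statement may enter as a cited fact. Every hypothesis is either
kernel-proved in this package or a verbatim quotation of a PUBLISHED theorem with page reference. The manuscript(s) under
audit are NOT citable for their own disputed steps — they are the thing under adjudication; programme-internal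
(2001/route/tribunal) claims are never citable.»  The rows transported in §2 are HYPOTHESIS SHAPES with free constants, never asserted.

PLACEMENT.  Cell result under the registered topic `Summits/QuantumFields/BalabanUV/Beta/` (β-lead (R34-2); ≤ 400 lines; theorems only).

WHY THIS LEAF.  Part 3 states the road-A2 END over the rooted literal `SpineRooted.JsBalAtOf hLc hr … := fun j ↦ dressAt hr (JsBal0AtOf … j)`
from rows on the UNDRESSED rescaled stencils `unitS_j S♭_j` and tables `unitW_j W_j` (the supplier-facing shape of
`HessKerDressedUnitsWall`).  Part 1's DIRECT END consumes rows on the jet data's OWN rescaled stencils / tables, i.e. on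
`unitS_j (𝔇_ρ S♭_j)` / `unitW_j (𝔇_ρ W_j)`, `𝔇_ρ` = the `S`- / `W`-field of `dressAt`.  The passage needs exactly: (i) `𝔇_ρ` is ADDITIVE
(differences of members, and member minus limit, pass) — §1, the window operator is a finite sum; (ii) `𝔇_ρ` COMMUTES WITH THE UNITS
`unitS_j`, `unitW_j` — §1, the leg factors `legScale s_f s_m` are constant on the field legs, which are the only legs `Πᵀ_ρ` mixes, and the
scalar `(s_f s_m)⁻¹` passes a linear map; (iii) `𝔇_ρ` PRESERVES `LocStencil` / `VertexFamily₂` at the SAME rate with constants `cK·(cK·(cK′·Cs))`,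
`cK·(cK·Cw)` — §2, an2's `locStencil_coProjAtK`, `locStencil_dressKAt`, `biLoc_dressKAt` BY NAME (`cK = AxialDressingRooted.cK d N δ`,
`cK′ = AxialDressingRooted.cK' d N δ`; in-block root `r ∈ box (d+1) N`, `1 ≤ N`, `0 ≤ δ`).

CONTENT (no `def`, no `Prop`).
* §1 `coProjAt_sub`, `legCo₁At_sub`, `legCo₂At_sub`, `dressKAt_sub`, `coProjAtK_sub`; `legCo₁At_smul`, `legCo₂At_smul`, `dressKAt_smul`;
  `legCo₁At_scaleK`, `legCo₂At_scaleK`, `dressKAt_scaleK`; family level `dressS_sub`, `dressW_sub`, **`unitS_dressS`**, **`unitW_dressW`**.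
* §2 `locStencil_dressS`, `locStencil_dressS_rate`, `vertexFamily₂_dressW`, `vertexFamily₂_dressW_rate`.
WHAT IS NOT HERE: any row for Bałaban's objects; anything about the wall (part 3).  NOT continuum, NOT Clay.
-/

open Finset
open scoped BigOperators
open Literature.MathematicalPhysics.QuantumFieldTheory.Balaban1983to89
open Literature.MathematicalPhysics.QuantumFieldTheory.Balaban1983to89.Beta
open ExpKernelCalculus (MKer BiLoc VertexFamily₂)
open HessKerRate (scaleK scaleK_apply)
open AffineAveraging (Form1 box toSite)
open OneStepResolventKernel (Fib LocStencil)
open HessKerDressedLimit (mker_sub_apply)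
open Summit.QuantumFields.BalabanUV.Beta.HessKerDressedUnits
open Summit.QuantumFields.BalabanUV.Beta.AxialDressingRooted (coProjAt coProjAt_apply legCo₁At legCo₂At legCo₁At_inl legCo₁At_inr
  legCo₂At_inl legCo₂At_inr dressKAt coProjAtK coProjAtK_eval locStencil_coProjAtK locStencil_dressKAt biLoc_dressKAt)

namespace Summit.QuantumFields.BalabanUV.Beta.AxialDressingRootedUnits

/-! ## §1 The rooted dressings are additive and commute with scalars and with leg-type-constant units -/

section Algebra

variable {d : ℕ} (ρ : Fin (d + 1) → ℤ) (N : ℕ)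

/-- [folklore] The window operator `Πᵀ_ρ` (a finite sum) is additive. -/
theorem coProjAt_sub (g h : Form1 (d + 1) ℝ) : coProjAt ρ N (g - h) = coProjAt ρ N g - coProjAt ρ N h := by
  funext α q
  simp only [coProjAt_apply, Pi.sub_apply, mul_sub, Finset.sum_sub_distrib]

/-- [folklore] `Πᵀ_ρ` on the first leg is additive. -/
theorem legCo₁At_sub (K K' : MKer (d + 1) (Fib d)) : legCo₁At ρ N (K - K') = legCo₁At ρ N K - legCo₁At ρ N K' := by
  funext x y a b
  rcases a with α | m
  · simp only [mker_sub_apply, legCo₁At_inl, coProjAt_apply, mul_sub, Finset.sum_sub_distrib]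
  · simp only [mker_sub_apply, legCo₁At_inr]

/-- [folklore] `Πᵀ_ρ` on the second leg is additive. -/
theorem legCo₂At_sub (K K' : MKer (d + 1) (Fib d)) : legCo₂At ρ N (K - K') = legCo₂At ρ N K - legCo₂At ρ N K' := by
  funext x y a b
  rcases b with β | m
  · simp only [mker_sub_apply, legCo₂At_inl, coProjAt_apply, mul_sub, Finset.sum_sub_distrib]
  · simp only [mker_sub_apply, legCo₂At_inr]

/-- [folklore] **THE ROOTED KERNEL DRESSING IS ADDITIVE**: `dressKAt ρ N (K − K′) = dressKAt ρ N K − dressKAt ρ N K′`. -/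
theorem dressKAt_sub (K K' : MKer (d + 1) (Fib d)) : dressKAt ρ N (K - K') = dressKAt ρ N K - dressKAt ρ N K' := by
  show legCo₂At ρ N (legCo₁At ρ N (K - K')) = legCo₂At ρ N (legCo₁At ρ N K) - legCo₂At ρ N (legCo₁At ρ N K')
  rw [legCo₁At_sub, legCo₂At_sub]

/-- [folklore] The bond-slot `Πᵀ_ρ` on `MKer`-valued stencil families is additive. -/
theorem coProjAtK_sub (S S' : Fin (d + 1) → (Fin (d + 1) → ℤ) → MKer (d + 1) (Fib d)) :
    coProjAtK ρ N (S - S') = coProjAtK ρ N S - coProjAtK ρ N S' := by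
  funext κ u x y a b
  simp only [coProjAtK_eval, Pi.sub_apply, coProjAt_apply, mul_sub, Finset.sum_sub_distrib]

/-- [folklore] `Πᵀ_ρ` on the first leg commutes with scalars. -/
theorem legCo₁At_smul (c : ℝ) (K : MKer (d + 1) (Fib d)) : legCo₁At ρ N (c • K) = c • legCo₁At ρ N K := by
  funext x y a b
  rcases a with α | m
  · simp only [Pi.smul_apply, smul_eq_mul, legCo₁At_inl, coProjAt_apply, Finset.mul_sum]
    exact Finset.sum_congr rfl fun v _ => Finset.sum_congr rfl fun β _ => by ring
  · simp only [Pi.smul_apply, smul_eq_mul, legCo₁At_inr]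

/-- [folklore] `Πᵀ_ρ` on the second leg commutes with scalars. -/
theorem legCo₂At_smul (c : ℝ) (K : MKer (d + 1) (Fib d)) : legCo₂At ρ N (c • K) = c • legCo₂At ρ N K := by
  funext x y a b
  rcases b with β | m
  · simp only [Pi.smul_apply, smul_eq_mul, legCo₂At_inl, coProjAt_apply, Finset.mul_sum]
    exact Finset.sum_congr rfl fun v _ => Finset.sum_congr rfl fun β _ => by ring
  · simp only [Pi.smul_apply, smul_eq_mul, legCo₂At_inr]

/-- [folklore] The rooted kernel dressing commutes with scalars. -/
theorem dressKAt_smul (c : ℝ) (K : MKer (d + 1) (Fib d)) : dressKAt ρ N (c • K) = c • dressKAt ρ N K := by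
  show legCo₂At ρ N (legCo₁At ρ N (c • K)) = c • legCo₂At ρ N (legCo₁At ρ N K)
  rw [legCo₁At_smul, legCo₂At_smul]

/-- [folklore] `Πᵀ_ρ` on the first leg commutes with a fibrewise rescaling whose LEFT factor is leg-type constant (`legScale s_f s_m`: one value
on all field legs) — `Πᵀ_ρ` mixes field legs among themselves only. -/
theorem legCo₁At_scaleK (sf sm : ℝ) (v : Fib d → ℝ) (K : MKer (d + 1) (Fib d)) :
    legCo₁At ρ N (scaleK (legScale sf sm) v K) = scaleK (legScale sf sm) v (legCo₁At ρ N K) := by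
  funext x y a b
  rcases a with α | m
  · simp only [legCo₁At_inl, scaleK_apply, legScale_inl, coProjAt_apply, Finset.mul_sum, Finset.sum_mul]
    exact Finset.sum_congr rfl fun w _ => Finset.sum_congr rfl fun β _ => by ring
  · simp only [legCo₁At_inr, scaleK_apply]

/-- [folklore] `Πᵀ_ρ` on the second leg commutes with a fibrewise rescaling whose RIGHT factor is leg-type constant. -/
theorem legCo₂At_scaleK (u : Fib d → ℝ) (sf sm : ℝ) (K : MKer (d + 1) (Fib d)) :
    legCo₂At ρ N (scaleK u (legScale sf sm) K) = scaleK u (legScale sf sm) (legCo₂At ρ N K) := by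
  funext x y a b
  rcases b with β | m
  · simp only [legCo₂At_inl, scaleK_apply, legScale_inl, coProjAt_apply, Finset.mul_sum, Finset.sum_mul]
    exact Finset.sum_congr rfl fun w _ => Finset.sum_congr rfl fun β' _ => by ring
  · simp only [legCo₂At_inr, scaleK_apply]

/-- [folklore] **THE ROOTED KERNEL DRESSING COMMUTES WITH LEG-TYPE-CONSTANT UNITS**: `dressKAt ρ N (D K D′) = D (dressKAt ρ N K) D′` for
`D = legScale s_f s_m`, `D′ = legScale s_f′ s_m′` (in particular with `unitK`, `counitK`). -/
theorem dressKAt_scaleK (sf sm sf' sm' : ℝ) (K : MKer (d + 1) (Fib d)) :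
    dressKAt ρ N (scaleK (legScale sf sm) (legScale sf' sm') K) = scaleK (legScale sf sm) (legScale sf' sm') (dressKAt ρ N K) := by
  show legCo₂At ρ N (legCo₁At ρ N _) = scaleK _ _ (legCo₂At ρ N (legCo₁At ρ N K))
  rw [legCo₁At_scaleK, legCo₂At_scaleK]

/-- [folklore] The rooted STENCIL dressing `S ↦ (κ,u) ↦ dressKAt ρ N (Πᵀ_ρ S κ u)` (the `S`-field of `dressAt`) is additive. -/
theorem dressS_sub (S S' : Fin (d + 1) → (Fin (d + 1) → ℤ) → MKer (d + 1) (Fib d)) :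
    ((fun κ u => dressKAt ρ N (coProjAtK ρ N S κ u)) - fun κ u => dressKAt ρ N (coProjAtK ρ N S' κ u)) =
      fun κ u => dressKAt ρ N (coProjAtK ρ N (S - S') κ u) := by
  funext κ u
  simp only [Pi.sub_apply, coProjAtK_sub, dressKAt_sub]

/-- [folklore] The rooted TABLE dressing `W ↦ (μ,y,ν,y′) ↦ dressKAt ρ N (W μ y ν y′)` (the `W`-field of `dressAt`) is additive. -/
theorem dressW_sub (W W' : Fin (d + 1) → (Fin (d + 1) → ℤ) → Fin (d + 1) → (Fin (d + 1) → ℤ) → MKer (d + 1) (Fib d)) :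
    ((fun μ y ν y' => dressKAt ρ N (W μ y ν y')) - fun μ y ν y' => dressKAt ρ N (W' μ y ν y')) =
      fun μ y ν y' => dressKAt ρ N ((W - W') μ y ν y') := by
  funext μ y ν y'
  simp only [Pi.sub_apply, dressKAt_sub]

/-- [folklore] **THE STENCIL UNITS PASS THROUGH THE ROOTED STENCIL DRESSING**: `unitS s_f s_m (𝔇_ρ S) = 𝔇_ρ (unitS s_f s_m S)` — the
scalar `(s_f s_m)⁻¹` and the contragredient conjugation `D⁻¹ · D⁻¹` commute with the bond-slot `Πᵀ_ρ` (entrywise) and with `dressKAt`. -/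
theorem unitS_dressS (sf sm : ℝ) (S : Fin (d + 1) → (Fin (d + 1) → ℤ) → MKer (d + 1) (Fib d)) :
    unitS sf sm (fun κ u => dressKAt ρ N (coProjAtK ρ N S κ u)) = fun κ u => dressKAt ρ N (coProjAtK ρ N (unitS sf sm S) κ u) := by
  funext κ u
  have h1 : coProjAtK ρ N (unitS sf sm S) κ u =
      (sf * sm)⁻¹ • scaleK (legScale sf⁻¹ sm⁻¹) (legScale sf⁻¹ sm⁻¹) (coProjAtK ρ N S κ u) := by
    funext x y a b
    simp only [coProjAtK_eval, unitS, counitK, Pi.smul_apply, smul_eq_mul, scaleK_apply, coProjAt_apply, Finset.mul_sum,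
      Finset.sum_mul]
    exact Finset.sum_congr rfl fun w _ => Finset.sum_congr rfl fun β _ => by ring
  rw [h1, dressKAt_smul, dressKAt_scaleK]
  rfl

/-- [folklore] **THE TABLE UNITS PASS THROUGH THE ROOTED TABLE DRESSING**: `unitW s_f s_m (𝔇_ρ W) = 𝔇_ρ (unitW s_f s_m W)`. -/
theorem unitW_dressW (sf sm : ℝ) (W : Fin (d + 1) → (Fin (d + 1) → ℤ) → Fin (d + 1) → (Fin (d + 1) → ℤ) → MKer (d + 1) (Fib d)) :
    unitW sf sm (fun μ y ν y' => dressKAt ρ N (W μ y ν y')) = fun μ y ν y' => dressKAt ρ N (unitW sf sm W μ y ν y') := by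
  funext μ y ν y'
  show counitK sf sm (dressKAt ρ N (W μ y ν y')) = dressKAt ρ N (counitK sf sm (W μ y ν y'))
  unfold counitK
  rw [dressKAt_scaleK]

end Algebra

/-! ## §2 Transport of the pointwise rows through the rooted dressing (an2's `AxialDressingRooted` bounds BY NAME) -/

section Transport

variable {d N : ℕ} (hN : 1 ≤ N) {r : Fin (d + 1) → ℕ} (hr : r ∈ box (d + 1) N)
  {S S' : Fin (d + 1) → (Fin (d + 1) → ℤ) → MKer (d + 1) (Fib d)}
  {W W' : Fin (d + 1) → (Fin (d + 1) → ℤ) → Fin (d + 1) → (Fin (d + 1) → ℤ) → MKer (d + 1) (Fib d)} {Cs Cw c t δ : ℝ}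
include hN hr

/-- [folklore] `LocStencil S Cs δ ⇒ LocStencil (𝔇_ρ S) (cK·(cK·(cK′·Cs))) δ` (`locStencil_coProjAtK` ∘ `locStencil_dressKAt`; = `dressAt.loc`). -/
theorem locStencil_dressS (hS : LocStencil S Cs δ) (hδ : 0 ≤ δ) :
    LocStencil (fun κ u => dressKAt (toSite r) N (coProjAtK (toSite r) N S κ u))
      (AxialDressingRooted.cK d N δ * (AxialDressingRooted.cK d N δ * (AxialDressingRooted.cK' d N δ * Cs))) δ :=
  locStencil_dressKAt hN hr (locStencil_coProjAtK hN hr hS hδ) hδ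

/-- [folklore] … and for a DEVIATION with constant `c·t`: `LocStencil (S − S′) (c·t) δ ⇒ LocStencil (𝔇_ρ S − 𝔇_ρ S′) ((cK·(cK·(cK′·c)))·t) δ`. -/
theorem locStencil_dressS_rate (hS : LocStencil (S - S') (c * t) δ) (hδ : 0 ≤ δ) :
    LocStencil ((fun κ u => dressKAt (toSite r) N (coProjAtK (toSite r) N S κ u)) -
        fun κ u => dressKAt (toSite r) N (coProjAtK (toSite r) N S' κ u))
      (AxialDressingRooted.cK d N δ * (AxialDressingRooted.cK d N δ * (AxialDressingRooted.cK' d N δ * c)) * t) δ := by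
  have h := locStencil_dressS hN hr hS hδ
  have e : AxialDressingRooted.cK d N δ * (AxialDressingRooted.cK d N δ * (AxialDressingRooted.cK' d N δ * (c * t))) =
      AxialDressingRooted.cK d N δ * (AxialDressingRooted.cK d N δ * (AxialDressingRooted.cK' d N δ * c)) * t := by ring
  rw [e, ← dressS_sub] at h
  exact h

/-- [folklore] `VertexFamily₂ W N Cw δ ⇒ VertexFamily₂ (𝔇_ρ W) N (cK·(cK·Cw)) δ` (`biLoc_dressKAt`; = `dressAt.loc₂`). -/
theorem vertexFamily₂_dressW (hW : VertexFamily₂ W N Cw δ) (hδ : 0 ≤ δ) :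
    VertexFamily₂ (fun μ y ν y' => dressKAt (toSite r) N (W μ y ν y')) N
      (AxialDressingRooted.cK d N δ * (AxialDressingRooted.cK d N δ * Cw)) δ :=
  fun μ y ν y' => biLoc_dressKAt hN hr (hW μ y ν y') hδ

/-- [folklore] … and for a DEVIATION with constant `c·t`. -/
theorem vertexFamily₂_dressW_rate (hW : VertexFamily₂ (W - W') N (c * t) δ) (hδ : 0 ≤ δ) :
    VertexFamily₂ ((fun μ y ν y' => dressKAt (toSite r) N (W μ y ν y')) - fun μ y ν y' => dressKAt (toSite r) N (W' μ y ν y')) N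
      (AxialDressingRooted.cK d N δ * (AxialDressingRooted.cK d N δ * c) * t) δ := by
  have h := vertexFamily₂_dressW hN hr hW hδ
  have e : AxialDressingRooted.cK d N δ * (AxialDressingRooted.cK d N δ * (c * t)) =
      AxialDressingRooted.cK d N δ * (AxialDressingRooted.cK d N δ * c) * t := by ring
  rw [e, ← dressW_sub] at h
  exact h

end Transport

end Summit.QuantumFields.BalabanUV.Beta.AxialDressingRootedUnits
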